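import Summits.BirchSwinnertonDyer.BirchSwinnertonDyer.Theorems.ThetaPartnerAtTwoMazurTateCongruenceAtTwoTopOfPublishedInputs
import Summits.BirchSwinnertonDyer.BirchSwinnertonDyer.Theorems.ThetaPartnerAtTwoMazurTateCongruenceAtTwoRMuInvariance
import Summits.BirchSwinnertonDyer.BirchSwinnertonDyer.Theorems.ThetaPartnerAtTwoSignedTransportAtTwoRankZeroOfGZK
import HarnessLib

/-!
# Crux `MazurTateCongruenceAtTwoTop` (stmt-BirchSwinnertonDyer-25797 = `MazurTateCongruenceAtTwoR` 21416): TWO CONSEQUENCES BY NAME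
# of the published inputs `PublishedInputsHeckeAtTwo` (item 27435) ALONE — Greenberg–Vatsal `μ`-invariance at `2` on the theta habitat,
# and K1 at the rank-0 partner (K1Ar) from Gross–Zagier–Kolyvagin
# (width seat bsd-wall-tp2-p1-w2 g4; `--supports stmt-BirchSwinnertonDyer-25797`; composition only, THEOREMS ONLY)

HONEST FRAMING. Every theorem below is CONDITIONAL on its displayed hypotheses: the five print facts of the HOLD bundle
`PublishedInputsHeckeAtTwo` (Eichler–Shimura for the depleted optimal quotient, Hecke self-duality of `J₀(N)`-torsion, Buzzard 2000
mod-`2` multiplicity one, Serre 1972 Prop. 12, Abbes–Ullmo Thm. A — cite-only, unproved in the tree) and, for §2, Gross–Zagier–Kolyvagin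
(`rank_eq_analyticRank_of_analyticRank_le_one`). NO research input, no `μ`-statement, no spanning node enters. Nothing closes an item;
BSD is not proved by any of this.

§1. `muInvarianceAtTwo_of_publishedInputsHeckeAtTwo : PublishedInputsHeckeAtTwo → (μ-INV₂)` — for every theta pair `(W, A)` (the
crux's binders: `W` non-CM of analytic rank `0`, `A` CM, both good supersingular at `2` with `a₂ = 0`, `W[2] ≃ A[2]` equivariantly), all
newforms and all Pollack pairs at `2`: `L♭_W` has a `2`-adic unit coefficient iff `L♭_A` does — the `p = 2` supersingular analogue of
[GreenbergVatsal2000, Thm. (1.4)] for these pairs, from PRINT ONLY: the lead's converse `flatIff_of_mazurTateCongruenceAtTwoTop` (p626036,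
period fact + crux ⟹ (μ-INV₂)) fed with w3 g0's `mazurTateCongruenceAtTwoTop_of_publishedInputsHeckeAtTwo` (p631563) and the Abbes–Ullmo road
to the period fact (`SkinnerUrban2014.realPeriodRat_eq_unit_mul_plusPeriod_two_fact_of_abbesUllmo`). The lead's
`muInvarianceAtTwo_of_fourFacts_ihara` (p631190) is the same with the Ihara hypothesis displayed; here it is discharged (w3's p631156).
Use for route ResidualThetaTransportAtTwo: on the habitat, `μ(L♭_W) = 0 ⟺ μ(L♭_A) = 0` granted PUB⁵, so a `μ = 0` input for the CM
partner transports to `W`.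

§2. `signedTransportAtTwo_rankZero_of_gzk_of_publishedInputsHeckeAtTwo : GZK → PublishedInputsHeckeAtTwo → K1Ar` — K1 at the rank-0
partner (the text of `SignedTransportAtTwo` with `A.analyticRank = 0` inserted; the conclusion of item 25785's twin VERBATIM) from
Gross–Zagier–Kolyvagin and the five print facts ALONE: tp2-p3-w3 g10's `SignedTransportAtTwo.signedTransportAtTwo_rankZero_of_gzk`
(p632271: GZK → `MazurTateCongruenceAtTwoR` → K1Ar, the four Poitou–Tate rows over `ℚ` being tree theorems) fed with w3 g0's
`mazurTateCongruenceAtTwoR_of_publishedInputsHeckeAtTwo`. So the K1 column of route ThetaPartnerAtTwo (director W-75 WINDOW 5 repair of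
the misstated 20333) rests on GZK + PUB⁵ and nothing else.

References: R. Greenberg, V. Vatsal, Invent. Math. 142 (2000) Thm. (1.4), §3 (13), Rem. 3.4; V. Vatsal, Duke Math. J. 98 (1999) Thm. (1.10);
K. Ribet, Proc. ICM 1983 (1984) Thm. 4.3; A. Abbes, E. Ullmo, Compositio Math. 103 (1996) Thm. A; B. D. Kim, Compos. Math. 145 (2009) Cor. 2.13.
-/

-- justification: the `Summit.BirchSwinnertonDyer.BirchSwinnertonDyer.…` path repeats a component (route-file convention)
set_option linter.dupNamespace false
set_option autoImplicit false

noncomputable section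

open scoped Classical MatrixGroups ModularForm

open CongruenceSubgroup WeierstrassCurve
  Literature.NumberTheory.EllipticCurves Literature.NumberTheory.EllipticCurves.ModularForms
  Literature.NumberTheory.EllipticCurves.Rank1Residual
  Summit.BirchSwinnertonDyer.Rank1Residual.Supersingular

namespace Summit.BirchSwinnertonDyer.BirchSwinnertonDyer.Theorems.MazurTateCongruenceAtTwoR

/-! ## §1. Greenberg–Vatsal `μ`-invariance at `2` on the theta habitat from the published inputs alone -/

/-- **(μ-INV₂) from five print facts.** Granted Eichler–Shimura (depleted optimal quotient), Hecke self-duality, Buzzard 2000, Serre 1972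
and Abbes–Ullmo Thm. A: for every theta pair, newforms and Pollack pairs at `2`, `L♭_W` has a unit coefficient iff `L♭_A` does. The Ihara
hypothesis of the lead's `muInvarianceAtTwo_of_fourFacts_ihara` is discharged by w3 g0's `stub_iharaSymbolModTwoNegDisc` (inside
`mazurTateCongruenceAtTwoTop_of_fiveFacts`). Conditional on the five named facts only; BSD is not proved by this.
[cite: GreenbergVatsal2000, Thm. (1.4), §3 (13) and Remark 3.4] [cite: AbbesUllmo1996, Thm. A] [cite: Ribet1984ICM, Thm. 4.3] -/
theorem muInvarianceAtTwo_of_fiveFacts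
    (hES : eichlerShimura_depletedOptimalQuotient_periodLattice_of_dvd) (hSD : heckeSelfDual_torsionBy_J0)
    (hBz : buzzard2000_multiplicityOne_gamma0) (hSe : serre1972_supersingular_decompositionSubgroup_image)
    (hAU : abbesUllmo_not_dvd_maninConstant_of_not_dvd_level) :
    ∀ (W : WeierstrassCurve ℚ) [W.IsElliptic] [W.IsGloballyMinimal] (A : WeierstrassCurve ℚ) [A.IsElliptic]
      [A.IsGloballyMinimal], ¬ W.HasCM → W.analyticRank = 0 → GoodSS W 2 → W.frobeniusTrace 2 = 0 → A.HasCM → GoodSS A 2 →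
      A.frobeniusTrace 2 = 0 →
      (∃ e : geomTorsion W (2 : ℤ) ≃+ geomTorsion A (2 : ℤ),
        ∀ (σ : Field.absoluteGaloisGroup ℚ) (P : geomTorsion W (2 : ℤ)), e (σ • P) = σ • e P) →
      ∀ [NeZero (W.conductorNorm ℤ)] (f : CuspForm (Gamma0 (W.conductorNorm ℤ)) 2), IsNewformOf W f →
      ∀ (Lplus Lminus : IwasawaAlgebra 2), IsPollackPair f 2 Lplus Lminus →
      ∀ [NeZero (A.conductorNorm ℤ)] (fA : CuspForm (Gamma0 (A.conductorNorm ℤ)) 2), IsNewformOf A fA →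
      ∀ (LplusA LminusA : IwasawaAlgebra 2), IsPollackPair fA 2 LplusA LminusA →
      ((∃ n : ℕ, IsUnit (PowerSeries.coeff n (kobayashiL 1 Lplus Lminus))) ↔
        (∃ n : ℕ, IsUnit (PowerSeries.coeff n (kobayashiL 1 LplusA LminusA)))) :=
  flatIff_of_mazurTateCongruenceAtTwoTop (SkinnerUrban2014.realPeriodRat_eq_unit_mul_plusPeriod_two_fact_of_abbesUllmo hAU)
    (mazurTateCongruenceAtTwoTop_of_fiveFacts hES hSD hBz hSe hAU)

/-- **(μ-INV₂) from the HOLD bundle `PublishedInputsHeckeAtTwo` (item 27435) alone**: Greenberg–Vatsal `μ`-invariance at the supersingular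
prime `2` for every theta pair — `(∃ n, IsUnit (coeff n L♭_W)) ↔ (∃ n, IsUnit (coeff n L♭_A))` for all newforms and Pollack pairs at `2`.
In particular a `μ(L♭_A) = 0` input for the CM partner gives `μ(L♭_W) = 0` (route ResidualThetaTransportAtTwo, cruxes Kμ⁺ / Kan⁺).
Conditional on the five print facts only; BSD is not proved by this. [cite: GreenbergVatsal2000, Thm. (1.4) and §3 (13)]
[cite: Vatsal1999, Thm. (1.10)] -/
theorem muInvarianceAtTwo_of_publishedInputsHeckeAtTwo
    (hPUB : Summit.BirchSwinnertonDyer.BirchSwinnertonDyer.Theses.ThetaPartnerAtTwo.PublishedInputsHeckeAtTwo) :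
    ∀ (W : WeierstrassCurve ℚ) [W.IsElliptic] [W.IsGloballyMinimal] (A : WeierstrassCurve ℚ) [A.IsElliptic]
      [A.IsGloballyMinimal], ¬ W.HasCM → W.analyticRank = 0 → GoodSS W 2 → W.frobeniusTrace 2 = 0 → A.HasCM → GoodSS A 2 →
      A.frobeniusTrace 2 = 0 →
      (∃ e : geomTorsion W (2 : ℤ) ≃+ geomTorsion A (2 : ℤ),
        ∀ (σ : Field.absoluteGaloisGroup ℚ) (P : geomTorsion W (2 : ℤ)), e (σ • P) = σ • e P) →
      ∀ [NeZero (W.conductorNorm ℤ)] (f : CuspForm (Gamma0 (W.conductorNorm ℤ)) 2), IsNewformOf W f →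
      ∀ (Lplus Lminus : IwasawaAlgebra 2), IsPollackPair f 2 Lplus Lminus →
      ∀ [NeZero (A.conductorNorm ℤ)] (fA : CuspForm (Gamma0 (A.conductorNorm ℤ)) 2), IsNewformOf A fA →
      ∀ (LplusA LminusA : IwasawaAlgebra 2), IsPollackPair fA 2 LplusA LminusA →
      ((∃ n : ℕ, IsUnit (PowerSeries.coeff n (kobayashiL 1 Lplus Lminus))) ↔
        (∃ n : ℕ, IsUnit (PowerSeries.coeff n (kobayashiL 1 LplusA LminusA)))) :=
  muInvarianceAtTwo_of_fiveFacts hPUB.1 hPUB.2.1 hPUB.2.2.1 hPUB.2.2.2.1 hPUB.2.2.2.2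

end Summit.BirchSwinnertonDyer.BirchSwinnertonDyer.Theorems.MazurTateCongruenceAtTwoR

/-! ## §2. K1 at the rank-0 partner (K1Ar) from Gross–Zagier–Kolyvagin and the published inputs alone -/

namespace Summit.BirchSwinnertonDyer.BirchSwinnertonDyer.Theorems.SignedTransportAtTwo

/-- **K1Ar from GZK + PUB⁵, nothing else**: the signed transport at `2` at the analytic-rank-`0` CM partner — for every theta pair with
`A.analyticRank = 0`, the partner's newform / Néron period ratio / Pollack pair, its signed structure (`X` torsion, `μ = 0`) and Kobayashi
main conjecture at `2`, and the factorisation `char X(W) · h = (2^m ϖ) · L♭_W`, Kobayashi's main conjecture for `W` at `2` follows —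
from Gross–Zagier–Kolyvagin and the five print facts of `PublishedInputsHeckeAtTwo`: tp2-p3-w3 g10's `signedTransportAtTwo_rankZero_of_gzk`
(GZK → `MazurTateCongruenceAtTwoR` → K1Ar; Poitou–Tate rows over `ℚ` are tree theorems) with the crux twin supplied by w3 g0's
`mazurTateCongruenceAtTwoR_of_publishedInputsHeckeAtTwo`. Conditional on GZK and the five named facts; closes no item; BSD is not proved
by this. [cite: GreenbergVatsal2000, Thm. (1.4), Props. (2.1), (2.4), (2.5), (2.8)] [cite: BDKim2009, Cor. 2.13] [cite: Kobayashi2003, Thm. 1.2]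
[cite: MilneADT2006, Ch. I, Thm. 4.10 (a)(b)(c), Cor. 4.16] -/
theorem signedTransportAtTwo_rankZero_of_gzk_of_publishedInputsHeckeAtTwo
    (hGZK : rank_eq_analyticRank_of_analyticRank_le_one)
    (hPUB : Summit.BirchSwinnertonDyer.BirchSwinnertonDyer.Theses.ThetaPartnerAtTwo.PublishedInputsHeckeAtTwo) :
    ∀ (W : WeierstrassCurve ℚ) [W.IsElliptic] [W.IsGloballyMinimal] (A : WeierstrassCurve ℚ) [A.IsElliptic] [A.IsGloballyMinimal], ¬ W.HasCM →
      W.analyticRank = 0 → Literature.NumberTheory.EllipticCurves.Rank1Residual.GoodSS W 2 → W.frobeniusTrace 2 = 0 →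
      A.HasCM → A.analyticRank = 0 → Literature.NumberTheory.EllipticCurves.Rank1Residual.GoodSS A 2 →
      A.frobeniusTrace 2 = 0 →
      (∃ e : WeierstrassCurve.geomTorsion W (2 : ℤ) ≃+ WeierstrassCurve.geomTorsion A (2 : ℤ), ∀ (σ : Field.absoluteGaloisGroup ℚ) (P : WeierstrassCurve.geomTorsion W (2 : ℤ)), e (σ • P) = σ • e P) →
      ∀ [NeZero (A.conductorNorm ℤ)] (fA : CuspForm (CongruenceSubgroup.Gamma0 (A.conductorNorm ℤ)) 2), Literature.NumberTheory.EllipticCurves.ModularForms.IsNewformOf A fA →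
      ∀ (ϖA : ℚ), (ϖA : ℝ) * A.realPeriodRat = Literature.NumberTheory.EllipticCurves.ModularForms.plusPeriod fA →
      ∀ (LsharpA LflatA : Literature.NumberTheory.EllipticCurves.IwasawaAlgebra 2), Summit.BirchSwinnertonDyer.Rank1Residual.Supersingular.IsPollackPair fA 2 LsharpA LflatA →
      (∀ (κ : Literature.NumberTheory.EllipticCurves.ZpExtension ℚ 2) (γ : Field.absoluteGaloisGroup ℚ), κ.IsCyclotomic →
      κ.IsTopGenerator γ →
      ∀ D : Literature.NumberTheory.EllipticCurves.Kobayashi2003.SignedSelmerDualData A κ γ 1, Module.IsTorsion (Literature.NumberTheory.EllipticCurves.IwasawaAlgebra 2) D.X ∧ D.mu = 0) →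
      Summit.BirchSwinnertonDyer.Rank1Residual.Supersingular.KobayashiMainConjecture A 2 1 →
      (∀ (κ : Literature.NumberTheory.EllipticCurves.ZpExtension ℚ 2) (γ : Field.absoluteGaloisGroup ℚ), κ.IsCyclotomic →
      κ.IsTopGenerator γ → Literature.NumberTheory.EllipticCurves.IsCyclotomicVariable 2 γ →
      ∀ [NeZero (W.conductorNorm ℤ)] (f : CuspForm (CongruenceSubgroup.Gamma0 (W.conductorNorm ℤ)) 2), Literature.NumberTheory.EllipticCurves.ModularForms.IsNewformOf W f →
      ∀ (ϖ : ℚ), (ϖ : ℝ) * W.realPeriodRat = Literature.NumberTheory.EllipticCurves.ModularForms.plusPeriod f →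
      ∀ (Lplus Lminus : Literature.NumberTheory.EllipticCurves.IwasawaAlgebra 2), Summit.BirchSwinnertonDyer.Rank1Residual.Supersingular.IsPollackPair f 2 Lplus Lminus →
      ∀ (D : Literature.NumberTheory.EllipticCurves.Kobayashi2003.SignedSelmerDualData W κ γ 1), ∃ (g h : Literature.NumberTheory.EllipticCurves.IwasawaAlgebra 2) (m : ℕ), D.charIdeal = Ideal.span {g} ∧ Literature.NumberTheory.EllipticCurves.iwasawaToPowerSeries 2 (g * h) = PowerSeries.C ((2 : ℚ_[2]) ^ m * (ϖ : ℚ_[2])) * Literature.NumberTheory.EllipticCurves.iwasawaToPowerSeries 2 (Summit.BirchSwinnertonDyer.Rank1Residual.Supersingular.kobayashiL 1 Lplus Lminus)) →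
      Summit.BirchSwinnertonDyer.Rank1Residual.Supersingular.KobayashiMainConjecture W 2 1 :=
  signedTransportAtTwo_rankZero_of_gzk hGZK (MazurTateCongruenceAtTwoR.mazurTateCongruenceAtTwoR_of_publishedInputsHeckeAtTwo hPUB)

end Summit.BirchSwinnertonDyer.BirchSwinnertonDyer.Theorems.SignedTransportAtTwo

end
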